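import Mathlib
import HarnessLib
import Summits.CriticalPhenomena.Ising3DConformalLimit.Theses.ArmDressing
import Summits.CriticalPhenomena.Ising3DConformalLimit.Theorems.ArmDressingBallConnectivityMoebiusLatticeTranslation
import Literature.Probability.LatticeModels.CriticalFKIsingConnectionLaws
import Literature.Probability.LatticeModels.FKIsingBarToRectangle
import Literature.Probability.LatticeModels.CriticalTwoPointLower

/-!
# `ArmDressing.EvenPatternDecoupling` — stub `stub_armBoxLimits` (PROVED)
(route `ArmDressing`, crux item stmt-CriticalPhenomena-16133, line `registered`)

The registered stub 5a of the reshaped skeleton of crux B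
(`Summit.CriticalPhenomena.Ising3DConformalLimit.Theses.ArmDressing.EvenPatternDecoupling`): for the
wired critical FK-Ising boxes `Λ_L ↑ ℤ³` (`q = 2`, `p = 1 - e^{-2β_c(3)}`), every mesh `δ > 0` with
`δ ≤ s_j`, and all data `c, r, b, s, z`, the two ARM box-probability sequences

* point arms: `L ↦ φ¹_{Λ_L}(∀ j, z_j^δ ↔ (B(c_j, r_j)ᶜ)^δ)`,
* ball arms: `L ↦ φ¹_{Λ_L}(∀ j, B̄(b_j, s_j)^δ ↔ (B(c_j, r_j)ᶜ)^δ)`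

converge as `L → ∞` to POSITIVE limits.

Proof. Both events are of the form "the open-path connection relation of a finite family `K` of
lattice probe sets, each finite or co-finite, lies in a set `R` of relations" (`R = CROSS n`), so the
sequences converge by the tree's thermodynamic limit of the critical FK-Ising connection laws
(`Literature.Probability.LatticeModels.tendsto_rcMeasure_real_connRelLaw_criticalBeta`, centred boxes
being the translates `Λ_L + 0`, `lt_boxLaw_eq`). Positivity of the limit is finite energy: each source
probe `K (castAdd i)` contains a lattice point `x_i` (for the inner balls: the rounded centre, since
`δ ≤ s_j`), each target probe `K (natAdd i)` is co-finite, so a straight lattice segment of `2r + 1`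
edges in the first coordinate direction leads from `x_i` into `K (natAdd i)` inside `Λ_L` for all
`L ≥ 3r + 1`; the event that all these `≤ n(2r+1)` edges are open implies the arm event and has
probability `≥ (p/(p + q(1-p)))^{n(2r+1)}` uniformly in `L` (FKG along edges,
`rcMeasure_real_inter_edgeOpen_ge`), and `p = 1 - e^{-2β_c(3)} > 0` by `β_c(3) > 0`
(`criticalBeta_pos_holds`). The limit of a sequence eventually above a positive constant is positive.

No hypothesis relating `b, s, c, r, z` is needed (if a source point already lies outside the outer
ball the arm holds trivially; the argument above does not even distinguish this case).

References: G. Grimmett, *The Random-Cluster Model* (2006), Thm. (3.1)(a), Thm. (3.8) (finite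
energy / FKG), Thm. (4.19) (thermodynamic limit). No definitions, no named facts, no `sorry`.
-/

set_option maxHeartbeats 1000000

namespace Summit.CriticalPhenomena.Ising3DConformalLimit.Theorems.EvenPatternDecoupling

open scoped Topology
open Filter Set Metric MeasureTheory
open Literature.Probability.LatticeModels Literature.Probability.Percolation
open Literature.Barriers.CriticalPhenomena
open Summit.CriticalPhenomena.Ising3DConformalLimit.ArmDressingBallConnectivityMoebius (lt_boxLaw_eq)

/-! ### Finite energy for a finite set of edges -/

/-- **All edges of a fixed finite set are open with probability `≥ (p/(p+q(1-p)))^{#E}`**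
(iterate Grimmett's finite-energy bound along the edges with FKG,
`rcMeasure_real_inter_edgeOpen_ge`). [cite: Grimmett2006, Thm. (3.8) and Thm. (3.1)(a)] -/
theorem rcMeasure_real_supset_ge_pow {V : Type*} [Fintype V] [DecidableEq V] (G : SimpleGraph V)
    [DecidableRel G.Adj] {p q : ℝ} (hp : p ∈ Set.Icc (0 : ℝ) 1) (hq : 1 ≤ q) (B : Set V)
    {E : Finset (Sym2 V)} (hE : E ⊆ G.edgeFinset) :
    (p / (p + q * (1 - p))) ^ E.card ≤ (rcMeasure G p q B).real {ω | (↑E : Set (Sym2 V)) ⊆ ω} := by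
  classical
  have hq0 : 0 < q := one_pos.trans_le hq
  haveI : IsProbabilityMeasure (rcMeasure G p q B) := isProbabilityMeasure_rcMeasure G hp hq0 B
  have hr0 : 0 ≤ p / (p + q * (1 - p)) := by
    apply div_nonneg hp.1
    nlinarith [hp.1, hp.2, hq0]
  induction E using Finset.induction_on with
  | empty =>
    rw [Finset.card_empty, pow_zero, show {ω : BondConfig V | ((∅ : Finset (Sym2 V)) : Set (Sym2 V)) ⊆ ω} =
      Set.univ from Set.eq_univ_of_forall fun ω => by simp, probReal_univ]
  | insert e E heE ih =>
    have he : e ∈ G.edgeFinset := hE (Finset.mem_insert_self e E)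
    have hE' : E ⊆ G.edgeFinset := (Finset.subset_insert e E).trans hE
    have hup : IsUpperSet {ω : BondConfig V | (↑E : Set (Sym2 V)) ⊆ ω} := fun _ _ hle h => h.trans hle
    have h1 := rcMeasure_real_inter_edgeOpen_ge G hp hq B hup he
    have hset : {ω : BondConfig V | (↑(insert e E) : Set (Sym2 V)) ⊆ ω} =
        {ω : BondConfig V | (↑E : Set (Sym2 V)) ⊆ ω} ∩ {ω | e ∈ ω} := by
      ext ω
      simp only [Finset.coe_insert, Set.insert_subset_iff, Set.mem_setOf_eq, Set.mem_inter_iff]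
      exact and_comm
    rw [Finset.card_insert_of_notMem heE, pow_succ, hset]
    calc (p / (p + q * (1 - p))) ^ E.card * (p / (p + q * (1 - p)))
        ≤ (rcMeasure G p q B).real {ω | (↑E : Set (Sym2 V)) ⊆ ω} * (p / (p + q * (1 - p))) :=
          mul_le_mul_of_nonneg_right (ih hE') hr0
      _ = p / (p + q * (1 - p)) * (rcMeasure G p q B).real {ω | (↑E : Set (Sym2 V)) ⊆ ω} := mul_comm _ _
      _ ≤ _ := h1

/-! ### Straight lattice segments inside a box -/

section Ray

variable {d : ℕ}

/-- The points `x + t e_{i₀}`, `t ≤ 2r + 1`, of a point `x ∈ Λ_r` lie in `Λ_L` for `L ≥ 3r + 1`.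
[folklore] -/
theorem add_single_natCast_mem_box {r L : ℕ} {x : Site d} (hx : x ∈ box d r) (i₀ : Fin d) {t : ℕ}
    (ht : t ≤ 2 * r + 1) (hL : 3 * r + 1 ≤ L) : x + Pi.single i₀ (t : ℤ) ∈ box d L := by
  rw [mem_box] at hx ⊢
  intro j
  have hj := hx j
  by_cases hji : j = i₀
  · subst hji
    rw [Pi.add_apply, Pi.single_eq_same]
    constructor <;> omega
  · rw [Pi.add_apply, Pi.single_eq_of_ne hji, add_zero]
    constructor <;> omega

/-- Consecutive points of the segment are lattice neighbours. [folklore] -/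
theorem zdGraph_adj_add_single_succ (x : Site d) (i₀ : Fin d) (t : ℕ) :
    (zdGraph d).Adj (x + Pi.single i₀ (t : ℤ)) (x + Pi.single i₀ ((t + 1 : ℕ) : ℤ)) :=
  (zdGraph_adj_iff _ _).2 ⟨i₀, Or.inl (by rw [Nat.cast_succ, Pi.single_add, add_assoc])⟩

/-- The endpoint `x + (2r+1) e_{i₀}` of the segment from `x ∈ Λ_r` lies outside `Λ_r`. [folklore] -/
theorem add_single_notMem_box {r : ℕ} {x : Site d} (hx : x ∈ box d r) (i₀ : Fin d) :
    x + Pi.single i₀ ((2 * r + 1 : ℕ) : ℤ) ∉ box d r := by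
  intro h
  have h1 := (mem_box.1 h i₀).2
  have h2 := (mem_box.1 hx i₀).1
  rw [Pi.add_apply, Pi.single_eq_same] at h1
  push_cast at h1
  omega

end Ray

/-! ### The uniform finite-energy lower bound for the arm events -/

/-- **Uniform lower bound for the arm events.** Let `K` be `n + n` probe sets of `ℤ^d` (`d ≥ 1`),
points `x_i ∈ K (castAdd i) ∩ Λ_r`, and `ℤ^d ∖ Λ_r ⊆ K (natAdd i)` for all `i`. Then for every
`L ≥ 3r + 1` the `φ¹_{Λ_L,p,q}`-probability (`0 ≤ p ≤ 1`, `q ≥ 1`) that every `K (castAdd i)` is joined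
inside `Λ_L` by an open path to `K (natAdd i)` is at least `(p/(p+q(1-p)))^{n(2r+1)}`: open the
`n` straight segments `x_i, x_i + e₁, …, x_i + (2r+1) e₁`. [cite: Grimmett2006, Thm. (3.8) and Thm. (3.1)(a)] -/
theorem rcMeasure_real_armEvent_ge_pow {d : ℕ} (hd : 0 < d) {p q : ℝ} (hp : p ∈ Set.Icc (0 : ℝ) 1)
    (hq : 1 ≤ q) {n : ℕ} (K : Fin (n + n) → Set (Site d)) {r : ℕ} (x : Fin n → Site d)
    (hxK : ∀ i, x i ∈ K (Fin.castAdd n i)) (hxr : ∀ i, x i ∈ box d r)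
    (hKr : ∀ i, (K (Fin.natAdd n i))ᶜ ⊆ ↑(box d r)) {L : ℕ} (hL : 3 * r + 1 ≤ L) :
    (p / (p + q * (1 - p))) ^ (n * (2 * r + 1)) ≤
      (rcMeasure (boxGraph d L) p q (boxBoundary d L)).real
        {ω | ∀ i : Fin n, ∃ a b : BoxV d L, a.1 ∈ K (Fin.castAdd n i) ∧ b.1 ∈ K (Fin.natAdd n i) ∧
          (openGraph ω).Reachable a b} := by
  classical
  have hq0 : 0 < q := one_pos.trans_le hq
  haveI : IsProbabilityMeasure (rcMeasure (boxGraph d L) p q (boxBoundary d L)) :=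
    isProbabilityMeasure_rcMeasure _ hp hq0 _
  set i₀ : Fin d := ⟨0, hd⟩
  -- the vertices of the segments (read in `Λ_L`; the junk branch is never taken) and their edges
  set v : Fin n → ℕ → BoxV d L := fun i t =>
    if h : x i + Pi.single i₀ (t : ℤ) ∈ box d L then ⟨_, h⟩ else ⟨0, zero_mem_box d L⟩ with hv_def
  have hv : ∀ i t, t ≤ 2 * r + 1 → (v i t).1 = x i + Pi.single i₀ (t : ℤ) := fun i t ht => by
    rw [hv_def]
    dsimp only
    rw [dif_pos (add_single_natCast_mem_box (hxr i) i₀ ht hL)]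
  have hadj : ∀ i t, t < 2 * r + 1 → (boxGraph d L).Adj (v i t) (v i (t + 1)) := by
    intro i t ht
    show (zdGraph d).Adj (v i t).1 (v i (t + 1)).1
    rw [hv i t ht.le, hv i (t + 1) ht]
    exact zdGraph_adj_add_single_succ (x i) i₀ t
  set E : Finset (Sym2 (BoxV d L)) :=
    (Finset.univ ×ˢ Finset.range (2 * r + 1)).image fun it => s(v it.1 it.2, v it.1 (it.2 + 1)) with hE_def
  have hE : E ⊆ (boxGraph d L).edgeFinset := by
    intro e he
    obtain ⟨⟨i, t⟩, hit, rfl⟩ := Finset.mem_image.1 he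
    rw [Finset.mem_product, Finset.mem_range] at hit
    exact SimpleGraph.mem_edgeFinset.2 (hadj i t hit.2)
  have hcard : E.card ≤ n * (2 * r + 1) :=
    Finset.card_image_le.trans (by rw [Finset.card_product, Finset.card_univ, Fintype.card_fin, Finset.card_range])
  -- all segment edges open forces every arm
  have hsub : {ω : BondConfig (BoxV d L) | (↑E : Set (Sym2 (BoxV d L))) ⊆ ω} ⊆
      {ω | ∀ i : Fin n, ∃ a b : BoxV d L, a.1 ∈ K (Fin.castAdd n i) ∧ b.1 ∈ K (Fin.natAdd n i) ∧
        (openGraph ω).Reachable a b} := by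
    intro ω hω i
    have hreach : ∀ t, t ≤ 2 * r + 1 → (openGraph ω).Reachable (v i 0) (v i t) := by
      intro t
      induction t with
      | zero => exact fun _ => SimpleGraph.Reachable.refl _
      | succ t ih =>
        intro ht
        have ht' : t < 2 * r + 1 := Nat.lt_of_succ_le ht
        refine (ih ht'.le).trans (SimpleGraph.Adj.reachable ((openGraph_adj ω _ _).2 ⟨?_, (hadj i t ht').ne⟩))
        exact hω (Finset.mem_coe.2 (Finset.mem_image.2 ⟨(i, t), Finset.mem_product.2
          ⟨Finset.mem_univ _, Finset.mem_range.2 ht'⟩, rfl⟩))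
    refine ⟨v i 0, v i (2 * r + 1), ?_, ?_, hreach _ le_rfl⟩
    · rw [hv i 0 (Nat.zero_le _), Nat.cast_zero, Pi.single_zero, add_zero]
      exact hxK i
    · rw [hv i (2 * r + 1) le_rfl]
      by_contra hmem
      exact add_single_notMem_box (hxr i) i₀ (hKr i hmem)
  -- finite energy
  have hr0 : 0 ≤ p / (p + q * (1 - p)) := by
    apply div_nonneg hp.1
    nlinarith [hp.1, hp.2, hq0]
  have hr1 : p / (p + q * (1 - p)) ≤ 1 :=
    div_le_one_of_le₀ (by nlinarith [hp.1, hp.2, hq0]) (by nlinarith [hp.1, hp.2, hq0])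
  calc (p / (p + q * (1 - p))) ^ (n * (2 * r + 1))
      ≤ (p / (p + q * (1 - p))) ^ E.card := pow_le_pow_of_le_one hr0 hr1 hcard
    _ ≤ (rcMeasure (boxGraph d L) p q (boxBoundary d L)).real {ω | (↑E : Set (Sym2 (BoxV d L))) ⊆ ω} :=
        rcMeasure_real_supset_ge_pow _ hp hq _ hE
    _ ≤ _ := measureReal_mono hsub (measure_ne_top _ _)

/-! ### Convergence to a positive limit -/

/-- **The critical FK-Ising arm probabilities of the wired boxes `Λ_L ↑ ℤ^d` (`d ≥ 3`) converge to a
positive limit**: for `n + n` probe sets each finite or co-finite, with non-empty sources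
`K (castAdd i)` and co-finite targets `K (natAdd i)`, the `φ¹_{Λ_L, 1-e^{-2β_c}, 2}`-probability
that every source is joined in `Λ_L` by an open path to its target tends, as `L → ∞`, to some
`a > 0` (thermodynamic limit of the connection laws, `tendsto_rcMeasure_real_connRelLaw_criticalBeta`,
plus the uniform finite-energy lower bound `rcMeasure_real_armEvent_ge_pow` and `β_c(d) > 0`).
[cite: Grimmett2006, Thm. (4.19) and Thm. (3.8)] -/
theorem exists_pos_tendsto_armEvent {d : ℕ} (hd : 3 ≤ d) {n : ℕ} (K : Fin (n + n) → Set (Site d))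
    (hK : ∀ i, (K i).Finite ∨ (K i)ᶜ.Finite) (hne : ∀ i : Fin n, (K (Fin.castAdd n i)).Nonempty)
    (hcof : ∀ i : Fin n, (K (Fin.natAdd n i))ᶜ.Finite) :
    ∃ a : ℝ, 0 < a ∧ Tendsto (fun L : ℕ =>
      (rcMeasure (boxGraph d L) (fkIsingParam (criticalBeta d)) 2 (boxBoundary d L)).real
        {ω | (fun i j => ∃ x y : BoxV d L, x.1 ∈ K i ∧ y.1 ∈ K j ∧ (openGraph ω).Reachable x y) ∈
          {R : Fin (n + n) → Fin (n + n) → Prop | ∀ i : Fin n, R (Fin.castAdd n i) (Fin.natAdd n i)}})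
      atTop (𝓝 a) := by
  have hd0 : 0 < d := by omega
  have hβ : 0 < criticalBeta d := criticalBeta_pos_holds (d := d) (by omega)
  have hp : fkIsingParam (criticalBeta d) ∈ Set.Icc (0 : ℝ) 1 :=
    fkIsingParam_mem_Icc (criticalBeta_nonneg d)
  have hp0 : 0 < fkIsingParam (criticalBeta d) := by
    have : Real.exp (-2 * criticalBeta d) < 1 := Real.exp_lt_one_iff.2 (by linarith)
    simp only [fkIsingParam]
    linarith
  -- convergence: the thermodynamic limit of the connection laws (centred boxes = `Λ_L + 0`)
  obtain ⟨ℓ, hℓ⟩ := tendsto_rcMeasure_real_connRelLaw_criticalBeta hd hK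
    {R : Fin (n + n) → Fin (n + n) → Prop | ∀ i : Fin n, R (Fin.castAdd n i) (Fin.natAdd n i)}
  have h1 : Tendsto (fun L : ℕ =>
      (rcMeasure (boxGraph d L) (fkIsingParam (criticalBeta d)) 2 (boxBoundary d L)).real
        {ω | (fun i j => ∃ x y : BoxV d L, x.1 ∈ K i ∧ y.1 ∈ K j ∧ (openGraph ω).Reachable x y) ∈
          {R : Fin (n + n) → Fin (n + n) → Prop | ∀ i : Fin n, R (Fin.castAdd n i) (Fin.natAdd n i)}})
      atTop (𝓝 ℓ) :=
    (hℓ 0).congr fun L => (lt_boxLaw_eq _ _ L K _).symm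
  -- positivity: a common radius for the source points and the complements of the targets
  choose x hx using hne
  have hfin : (Set.range x ∪ ⋃ i : Fin n, (K (Fin.natAdd n i))ᶜ).Finite :=
    (Set.finite_range x).union (Set.finite_iUnion hcof)
  obtain ⟨r, hr⟩ := exists_subset_box_of_set_finite hfin
  have hxr : ∀ i, x i ∈ box d r := fun i =>
    Finset.mem_coe.1 (hr (Set.mem_union_left _ (Set.mem_range_self i)))
  have hKr : ∀ i, (K (Fin.natAdd n i))ᶜ ⊆ ↑(box d r) := fun i y hy =>
    hr (Set.mem_union_right _ (Set.mem_iUnion.2 ⟨i, hy⟩))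
  set π : ℝ := fkIsingParam (criticalBeta d) /
    (fkIsingParam (criticalBeta d) + 2 * (1 - fkIsingParam (criticalBeta d))) with hπ
  have hπ0 : 0 < π := div_pos hp0 (by nlinarith [hp.1, hp.2])
  have hbound : ∀ L : ℕ, 3 * r + 1 ≤ L → π ^ (n * (2 * r + 1)) ≤
      (rcMeasure (boxGraph d L) (fkIsingParam (criticalBeta d)) 2 (boxBoundary d L)).real
        {ω | (fun i j => ∃ x y : BoxV d L, x.1 ∈ K i ∧ y.1 ∈ K j ∧ (openGraph ω).Reachable x y) ∈
          {R : Fin (n + n) → Fin (n + n) → Prop | ∀ i : Fin n, R (Fin.castAdd n i) (Fin.natAdd n i)}} :=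
    fun L hL => rcMeasure_real_armEvent_ge_pow hd0 hp one_le_two K x hx hxr hKr hL
  have hℓ0 : π ^ (n * (2 * r + 1)) ≤ ℓ := ge_of_tendsto h1 (eventually_atTop.2 ⟨3 * r + 1, hbound⟩)
  exact ⟨ℓ, lt_of_lt_of_le (pow_pos hπ0 _) hℓ0, h1⟩

/-! ### Discretised balls: finiteness, and a lattice point in every inner ball -/

/-- For `δ > 0` the discretisation `{x ∈ ℤ^d | δx ∈ A}` of a bounded set `A ⊆ ℝ^d` is finite.
[folklore] -/
theorem finite_disc_of_isBounded {d : ℕ} {δ : ℝ} (hδ : 0 < δ) {A : Set (EuclideanSpace ℝ (Fin d))}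
    (hA : Bornology.IsBounded A) :
    {x : Site d | (WithLp.toLp 2 fun i => δ * (x i : ℝ) : EuclideanSpace ℝ (Fin d)) ∈ A}.Finite := by
  obtain ⟨R, hR⟩ := hA.subset_closedBall 0
  refine (box d ⌈R / δ⌉₊).finite_toSet.subset fun x hx => ?_
  have hx' := hR hx
  rw [mem_closedBall, dist_zero_right] at hx'
  rw [Finset.mem_coe, mem_box]
  intro i
  have hi : |δ * (x i : ℝ)| ≤ R := by
    refine le_trans ?_ hx'
    have h := PiLp.norm_apply_le (WithLp.toLp 2 fun i => δ * (x i : ℝ) : EuclideanSpace ℝ (Fin d)) i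
    rwa [PiLp.toLp_apply, Real.norm_eq_abs] at h
  rw [abs_mul, abs_of_pos hδ] at hi
  have h2 : |(x i : ℝ)| ≤ ⌈R / δ⌉₊ := by
    have h3 : |(x i : ℝ)| ≤ R / δ := by rw [le_div_iff₀ hδ, mul_comm]; exact hi
    exact h3.trans (Nat.le_ceil _)
  have h4 : |x i| ≤ (⌈R / δ⌉₊ : ℤ) := by exact_mod_cast h2
  exact abs_le.1 h4

/-- For `0 < δ ≤ s` the closed ball `B̄(b, s) ⊆ ℝ³` contains a point of the lattice `δℤ³`: the
rounded centre `(δ · round(b_i/δ))_i` is within `δ√3/2 < δ` of `b`. [folklore] -/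
theorem exists_mesh_mem_closedBall {δ : ℝ} (hδ : 0 < δ) (b : EuclideanSpace ℝ (Fin 3)) {s : ℝ}
    (hs : δ ≤ s) :
    ∃ x : Site 3, (WithLp.toLp 2 fun i => δ * (x i : ℝ) : EuclideanSpace ℝ (Fin 3)) ∈ closedBall b s := by
  refine ⟨fun i => round (b i / δ), ?_⟩
  rw [mem_closedBall, EuclideanSpace.dist_eq]
  have hterm : ∀ i : Fin 3, dist ((WithLp.toLp 2 fun i => δ * ((round (b i / δ) : ℤ) : ℝ) :
      EuclideanSpace ℝ (Fin 3)) i) (b i) ^ 2 ≤ (δ / 2) ^ 2 := by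
    intro i
    rw [PiLp.toLp_apply, Real.dist_eq]
    have h1 : |δ * ((round (b i / δ) : ℤ) : ℝ) - b i| ≤ δ / 2 := by
      have h2 : δ * ((round (b i / δ) : ℤ) : ℝ) - b i = δ * (((round (b i / δ) : ℤ) : ℝ) - b i / δ) := by
        field_simp
      rw [h2, abs_mul, abs_of_pos hδ, abs_sub_comm]
      have h3 := abs_sub_round (b i / δ)
      nlinarith
    have h0 : 0 ≤ |δ * ((round (b i / δ) : ℤ) : ℝ) - b i| := abs_nonneg _
    nlinarith
  have hsum : ∑ i : Fin 3, dist ((WithLp.toLp 2 fun i => δ * ((round (b i / δ) : ℤ) : ℝ) :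
      EuclideanSpace ℝ (Fin 3)) i) (b i) ^ 2 ≤ δ ^ 2 := by
    calc _ ≤ ∑ _i : Fin 3, (δ / 2) ^ 2 := Finset.sum_le_sum fun i _ => hterm i
      _ = 3 * (δ / 2) ^ 2 := by rw [Finset.sum_const, Finset.card_univ, Fintype.card_fin]; simp
      _ ≤ δ ^ 2 := by nlinarith
  calc Real.sqrt _ ≤ Real.sqrt (δ ^ 2) := Real.sqrt_le_sqrt hsum
    _ = δ := Real.sqrt_sq hδ.le
    _ ≤ s := hs

/-! ### The stub -/

-- the registered stub signature is the crux's full `let` preamble, most of which is not used by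
-- this clause (linter.unusedVariables would flag the verbatim statement)
set_option linter.unusedVariables false in
/-- stub 5a of the reshaped skeleton of crux `EvenPatternDecoupling` (line `registered`), PROVED:
**the wired-box ARM probabilities converge as `L → ∞` to POSITIVE limits** — for every mesh `δ > 0`
not exceeding the inner radii and all data: the point arms `∀ j, z_j^δ ↔ (B(c_j,r_j)ᶜ)^δ` and the
ball arms `∀ j, B̄(b_j,s_j)^δ ↔ (B(c_j,r_j)ᶜ)^δ`. Convergence: the thermodynamic limit of the critical
FK-Ising connection laws (`tendsto_rcMeasure_real_connRelLaw_criticalBeta`: ghost-wired events are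
antitone in the box, the arm correction vanishes by `m*(β_c(3)) = 0`); positivity: finite energy
along `n` straight lattice segments (`rcMeasure_real_armEvent_ge_pow`) and `β_c(3) > 0`; a lattice
point lies in each inner ball since `δ ≤ s_j` (`exists_mesh_mem_closedBall`).
[cite: Grimmett2006, Thm. (4.19) and Thm. (3.8)] -/
theorem stub_armBoxLimits : open Literature.Probability.LatticeModels Literature.Probability.Percolation Literature.Barriers.CriticalPhenomena Filter Topology in let E3 := EuclideanSpace ℝ (Fin 3); let μ : (L : ℕ) → MeasureTheory.Measure (BondConfig (BoxV 3 L)) := fun L => rcMeasure (boxGraph 3 L) (fkIsingParam (criticalBeta 3)) 2 (boxBoundary 3 L); let PrL : (m : ℕ) → (Fin m → Set (Site 3)) → Set (Fin m → Fin m → Prop) → ℕ → ℝ := fun _ K R L => (μ L).real {ω | (fun i j => ∃ x y : BoxV 3 L, x.1 ∈ K i ∧ y.1 ∈ K j ∧ (openGraph ω).Reachable x y) ∈ R}; let Pr : (m : ℕ) → (Fin m → Set (Site 3)) → Set (Fin m → Fin m → Prop) → ℝ := fun m K R => limUnder atTop (PrL m K R); let mesh : ℝ → Site 3 → E3 :=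 fun δ z => WithLp.toLp 2 fun i : Fin 3 => δ * (z i : ℝ); let disc : ℝ → Set E3 → Set (Site 3) := fun δ A => {x | mesh δ x ∈ A}; let EVEN : (n : ℕ) → Set (Fin n → Fin n → Prop) := fun n => {R | ∀ i, Even ({j : Fin n | R i j}.ncard)}; let EVEN2 : (n : ℕ) → Set (Fin (n + n) → Fin (n + n) → Prop) := fun n => {R | ∀ i : Fin n, Even ({j : Fin n | R (Fin.castAdd n i) (Fin.castAdd n j)}.ncard)}; let CROSS : (n : ℕ) → Set (Fin (n + n) → Fin (n + n) → Prop) := fun n => {R | ∀ i : Fin n, R (Fin.castAdd n i) (Fin.natAdd n i)}; let pts : (n : ℕ) → ℝ → (Fin n → E3) → (Fin n → Set (Site 3)) := fun _ δ z j => {latticeApprox δ (z j)}; let fam : (n : ℕ) → ℝ → (Fin n → Set E3) → (Fin n → Set E3) → (Fin (n + n) → Set (Site 3)) := fun _ δ A B => Fin.append (fun j => disc δ (A j)) (fun j => disc δ (B j)); let Supp : (L : ℕ) → Set (BondConfig (BoxV 3 L)) := fun L => {ω | ω ⊆ (boxGraph 3 L).edgeSet}; let Ev : (m : ℕ) → (Fin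 m → Set (Site 3)) → Set (Fin m → Fin m → Prop) → (L : ℕ) → Set (BondConfig (BoxV 3 L)) := fun _ K R L => {ω | (fun i j => ∃ x y : BoxV 3 L, x.1 ∈ K i ∧ y.1 ∈ K j ∧ (openGraph ω).Reachable x y) ∈ R}; let Out : (n : ℕ) → ℝ → (Fin n → E3) → (Fin n → ℝ) → (L : ℕ) → Set (BoxV 3 L) := fun _ δ b s L => {x | ∀ k, mesh δ x.1 ∉ Metric.closedBall (b k) (s k)}; let RO : (L : ℕ) → BondConfig (BoxV 3 L) → Set (BoxV 3 L) → BoxV 3 L → BoxV 3 L → Prop := fun L ω O x y => (SimpleGraph.fromRel fun a a' : BoxV 3 L => s(a, a') ∈ ω ∧ a ∈ O ∧ a' ∈ O).Reachable x y; let Crs : (n : ℕ) → ℝ → (Fin n → E3) → (Fin n → ℝ) → (Fin n → E3) → (Fin n → ℝ) → (L : ℕ) → BondConfig (BoxV 3 L) → Fin n → BoxV 3 L → Prop := fun n δ c r b s L ω j x => x ∈ Out n δ b s L ∧ (∃ y : BoxV 3 L, mesh δ y.1 ∈ Metric.closedBall (b j) (s j) ∧ (boxGraph 3 L).Adj x y)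 ∧ (∃ y : BoxV 3 L, y ∈ Out n δ b s L ∧ mesh δ y.1 ∈ (Metric.ball (c j) (r j))ᶜ ∧ RO L ω (Out n δ b s L) x y); let Uni : (n : ℕ) → ℝ → (Fin n → E3) → (Fin n → ℝ) → (Fin n → E3) → (Fin n → ℝ) → (L : ℕ) → Set (BondConfig (BoxV 3 L)) := fun n δ c r b s L => {ω | ∀ (j : Fin n) (x x' : BoxV 3 L), Crs n δ c r b s L ω j x → Crs n δ c r b s L ω j x' → RO L ω (Out n δ b s L) x x'}; let Patt : (n : ℕ) → ℝ → (Fin n → E3) → (Fin n → ℝ) → (Fin n → E3) → (Fin n → ℝ) → (L : ℕ) → Set (BondConfig (BoxV 3 L)) := fun n δ c r b s L => {ω | (fun i j => ∃ x x' : BoxV 3 L, Crs n δ c r b s L ω i x ∧ Crs n δ c r b s L ω j x' ∧ RO L ω (Out n δ b s L) x x') ∈ EVEN n}; ∀ (n : ℕ) (c : Fin n → E3) (r : Fin n → ℝ) (b : Fin n → E3) (s : Fin n → ℝ) (z : Fin n → E3) (δ : ℝ), 0 < δ → (∀ j, δ ≤ s j) → (∃ a : ℝ, 0 < a ∧ Tendsto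 (PrL (n + n) (Fin.append (pts n δ z) (fun j => disc δ (Metric.ball (c j) (r j))ᶜ)) (CROSS n)) atTop (𝓝 a)) ∧ (∃ a : ℝ, 0 < a ∧ Tendsto (PrL (n + n) (fam n δ (fun j => Metric.closedBall (b j) (s j)) (fun j => (Metric.ball (c j) (r j))ᶜ)) (CROSS n)) atTop (𝓝 a)) := by
  dsimp only
  intro n c r b s z δ hδ hs
  have hcof : ∀ j : Fin n, ({x : Site 3 | (WithLp.toLp 2 fun i => δ * (x i : ℝ) : EuclideanSpace ℝ (Fin 3)) ∈
      (ball (c j) (r j))ᶜ}ᶜ).Finite := by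
    intro j
    simp only [Set.compl_setOf, Set.mem_compl_iff, not_not]
    exact finite_disc_of_isBounded hδ isBounded_ball
  constructor
  · refine exists_pos_tendsto_armEvent (d := 3) le_rfl _ (fun i => ?_) (fun j => ?_) (fun j => ?_)
    · refine Fin.addCases (fun j => ?_) (fun j => ?_) i
      · simp only [Fin.append_left]
        exact Or.inl (Set.finite_singleton _)
      · simp only [Fin.append_right]
        exact Or.inr (hcof j)
    · simp only [Fin.append_left]
      exact Set.singleton_nonempty _
    · simp only [Fin.append_right]
      exact hcof j
  · refine exists_pos_tendsto_armEvent (d := 3) le_rfl _ (fun i => ?_) (fun j => ?_) (fun j => ?_)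
    · refine Fin.addCases (fun j => ?_) (fun j => ?_) i
      · simp only [Fin.append_left]
        exact Or.inl (finite_disc_of_isBounded hδ isBounded_closedBall)
      · simp only [Fin.append_right]
        exact Or.inr (hcof j)
    · simp only [Fin.append_left]
      exact exists_mesh_mem_closedBall hδ (b j) (hs j)
    · simp only [Fin.append_right]
      exact hcof j

end Summit.CriticalPhenomena.Ising3DConformalLimit.Theorems.EvenPatternDecoupling
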